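import HarnessLib
import HarnessLib.Audit
import HarnessLib.Audit.TribunalTags

/-!
# Strong-Hypothesis Library — summit `Langlands` (D-0034, skeleton)

The REGISTRY of known strong hypotheses `H` (open conjectures with `H ⇒ P` landed or printed) and of known
EQUIVALENT REFORMULATIONS `E` (`E ⇔ P` in print) for the single-problem summit `Langlands`; the kernel
tribunal (`#h21_tribunal`, D-0033 T1 rule (a)) probes every decl tagged
`@[strong_hypothesis "Langlands.Langlands"]` against a route crux `C` for `H → C`. Bridges live summit-side
in `Summits/Langlands/StrongHypotheses.lean`. SKELETON (2026-08-17): census complete, ZERO decls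
registered — see "Why the registry is empty" — and zero new decls stated.

## The problem

* `Langlands : Prop` (root name; `Summits/Langlands/Langlands/Statement.lean`, `[problem: lang]`): **global
  Langlands reciprocity for `GL_n` over number fields, BOTH directions, ALL finite places** — for every
  number field `F`, `Nonempty (Summit.Langlands.ReciprocityData F)` and, for ALL reciprocity data `𝓡`
  (Henniart-normalised local Langlands correspondences `rec_v` at every finite `v`, local Artin maps PINNED
  to `canonicalArtin (F_v)`; Fontaine's `D_pst` datum at `v ∣ ℓ` pinned and not part of `𝓡`) and every
  `n ≥ 1`: (A) `AutomorphicToGalois` — every L-algebraic cuspidal `π` of `GL_n(𝔸_F)` has, for all `ℓ`,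
  `ι : ℚ̄_ℓ ≃ ℂ`, an irreducible geometric `ρ_{π,ι}`, Satake–Frobenius compatible at almost all `v` and
  local–global compatible (`ι WD(ρ|_{Γ_{F_v}})^{F-ss} ≅ rec_v(π_v)`) at EVERY finite `v`, unique up to
  conjugacy; (B) `GaloisToAutomorphic` — every irreducible geometric `ρ` so arises. Printed sources:
  Buzzard–Gee 2014 Conj. 3.2.1/3.2.2 for `G = GL_n` (canonical text), Taylor 2004 Conj. 7–8 (Conj. 3.4/3.5
  of the Toulouse version), Fontaine–Mazur 1995 Conj. 1, Clozel 1990 Conj. 4.5 (C-algebraic form).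
  Functoriality for a general reductive `G` is OUT of scope of the problem (D-0018(1)).

## Census of candidate strong hypotheses / equivalent criteria

| # | `H` / `E` | one-line statement | relation to `P` | source | status here | bridge |
|---|---|---|---|---|---|---|
| 1 | Buzzard–Gee reciprocity for EVERY connected reductive `G/F` | Conj. 3.2.1/3.2.2 verbatim: L-algebraic `π` on `G(𝔸_F)` ↦ `ρ_π : Γ_F → ᴸG(ℚ̄_p)`, compatible with `r_{π_v}` at `v ∉ S`, de Rham above `p` (and the converse surjectivity onto L-parameters of geometric type) | strictly stronger (`P` is the case `G = GL_n`, where the strong form at bad places is statable) | Buzzard–Gee 2014, §3.2 (Conj. 3.2.1, 3.2.2) and §8.1 [BuzzardGeeLMS2014] | not typeable (missing: L-group `ᴸG = Ĝ ⋊ Γ_F`, automorphic representations of a general `G(𝔸_F)`, local Langlands / `r_{π_v}` for `G ≠ GL_n`; the tree's `AutomorphyDatum` is `gl n K` only) | none (specialisation `G := GL_n` is immediate in print) |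
| 2 | automorphic Langlands group | existence of a locally compact group `L_F → W_F` with `Rep_n(L_F)` = isobaric automorphic representations of `GL_n(𝔸_F)` compatibly with `L_{F_v}` at every place, and a surjection `L_F → 𝒢_{mot,F}(ℚ̄_ℓ)`-points onto the motivic Galois group on algebraic representations | strictly stronger (reciprocity for algebraic `π` = restriction along `L_F → 𝒢_mot → Γ_F`-realisation; also yields functoriality) | Langlands 1979 ("Automorphic representations, Shimura varieties, and motives. Ein Märchen", Corvallis Part 2, §2–4); Arthur 2002 ("A note on the automorphic Langlands group", Canad. Math. Bull. 45, §§1–2); no bib key for either yet — nearest held keys [LanglandsCorvallis1979Notion], [Langlands2001] | not typeable (missing: Tannakian category of isobaric representations with fibre functor, `L_F`, motivic Galois group; Mathlib has no linear algebraic groups / Tannaka duality) | none |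
| 3 | Clozel's motivic reciprocity | Conj. 4.5: algebraic (= C-algebraic isobaric) cuspidal `π` on `GL_n(𝔸_F)` ↔ irreducible rank-`n` motives over `F` with coefficients, `L(s, π_f) = L(s, M)`; with Conj. 4.16 (purity) | ALONE incomparable (motives, not Galois representations); jointly with the Tate conjecture and Fontaine–Mazur (row 5) it is EXPECTED to yield `P` (the motivic picture of Taylor 2004 §§1–3), but no single printed proof of the joint implication at ALL places was located — bridge none | Clozel 1990, §4 Conj. 4.5, 4.16 [Clozel1990 (interim key)]; Taylor 2004 §§1–3 [TaylorGaloisRepresentations2004] | not typeable (missing: pure motives over `F` with coefficients in `E ⊂ ℂ` and their `λ`-adic / de Rham realisations MATCHED to `π` at all places; the tree has only per-variety `HasseWeilData` / `EtaleRealization` interfaces) | none |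
| 4 | C-algebraic normalisation of `P` (Clozel form) | `P` with "L-algebraic" replaced by "C-algebraic" and `ρ` attached to `π ⊗ |det|^{(1-n)/2}` (Buzzard–Gee §8.1: "Conjecture 3.2.2 holds for `π ⊗ |·|^{(n-1)/2}`") | equivalent (transport along the bijection `π ↦ π ⊗ |det|^{(n-1)/2}` between C- and L-algebraic cuspidal `π` of `GL_n`; BG §5.3 and §8.1) | Clozel 1990 Déf. 1.8, Conj. 4.5; Buzzard–Gee 2014 §5.3, §8.1 [BuzzardGeeLMS2014] | candidate (not yet in tree): typeable with `AutomorphicRepData.IsCAlgebraic` (`AutomorphicRepsGL`) and the twist API of `AlgebraicityTwist`, but it is a ~40-line restatement of (A) ∧ (B) — outside the skeleton budget and a near-restatement of the problem (CONVENTIONS §4; D-0015(3) already rules it "not restated") | none (would be LANDED via the twist lemmas once stated) |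
| 5 | Fontaine–Mazur Conj. 1 | every irreducible geometric `ρ : Γ_F → GL_n(ℚ_ℓ)` comes from geometry (subquotient of some `Hⁱ_ℓ(X)(j)`) | incomparable alone (no automorphy); with row 3 + Tate expected to give (B) | Fontaine–Mazur 1995 §1 Conj. 1 [FontaineMazurGeometric1995] | in tree but NOT registrable: `Literature.NumberTheory.Automorphic.FontaineMazurConjecture 𝔅 E` (`LangHasseWeil.lean`) is a PARAMETRISED predicate (period-ring data `𝔅`, étale realisations `E`), `ℚ_ℓ`-coefficients, and does not imply `P` | none |
| 6 | Fontaine–Mazur–Langlands for `GL_n`, a.e. form (lang.S03) | every irreducible geometric `ρ` matches an L-algebraic cuspidal `π` at almost all places | WEAKER (consequence of direction (B) of `P`; local–global compatibility at the remaining places dropped) | Fontaine–Mazur 1995 Conj. 1 + Buzzard–Gee Conj. 3.2.2 | in tree, NOT registered (weaker; parametrised): `Literature.NumberTheory.Automorphic.FontaineMazurLanglandsGLn 𝔅 n` (`ReciprocityGLn.lean`) | — |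
| 7 | Artin's conjecture | `L(s, ρ)` entire for irreducible non-trivial Artin `ρ` | WEAKER (consequence of (B) for finite-image `ρ` + local–global compatibility: `L(s, ρ) = L(s, π)` entire; Langlands 1970, comments to Question 2) | Artin 1923; Langlands 1970 [Langlands1970] | in tree, NOT registered (weaker): `Literature.NumberTheory.Automorphic.ArtinConjecture` (`ArtinLFunctions.lean`, closed `Prop`, `@[conjecture]`) | — |
| 8 | Langlands functoriality `GL_m → GL_n` (lang.S04, L-homomorphism trivial on `Γ_F`) | weak transfer along every algebraic `r : GL_m(ℂ) → GL_n(ℂ)` | incomparable (carries no Galois information; full functoriality `ᴸH → ᴸG` with `H = {1}` contains only the finite-image (Artin) case of (B)) | Langlands 1970 Questions 1–2; Borel, Corvallis 1979 §§15–17 [Langlands1970] [Corvallis1979] | in tree, NOT registered (incomparable; parametrised `m n K hm hn`): `Literature.NumberTheory.Automorphic.FunctorialityGLConjecture` (`Sweep2.lean`) | — |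
| 9 | generalized Ramanujan for `GL_n` (lang) | cuspidal unitary `π` on `GL_n(𝔸_F)` is tempered at every place | incomparable (follows from functoriality of all `Symᵏ`/Rankin products, or from `P` + Deligne purity only where `ρ_π` is known motivic) | Langlands 1970; Jacquet–Shalika 1981 | in tree, NOT registered (incomparable; parametrised by `n`): `Literature.NumberTheory.Automorphic.RamanujanConjectureGL n` (`AutomorphicGLn.lean`) | — |
| 10 | GRH-type hypotheses used by routes as conditional inputs | `ExtendedRiemannHypothesis` (Dedekind zeta), `GrandRiemannHypothesisGL`, `AutomorphicGRH` (`Literature.NumberTheory.LFunctions.*`) | incomparable (do not imply reciprocity; some routes, e.g. `Theses/GaloisWeightedBE`, `Cruxes/ExtendedRiemannHypothesis`, ASSUME them) | Iwaniec–Kowalski 2004 §5.7 | in tree, NOT registered for THIS summit (they are registered for `RiemannHypothesis`) | — |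

## Why the registry is empty (deliberately NOT registered)

* The summit as typed is already the STRONGEST `GL_n` statement in print (both directions, every finite
  place, `∀` Henniart-normalised reciprocity data). Every printed statement strictly above it (rows 1–3)
  needs vocabulary the tree lacks (L-groups of general `G`, the Langlands group, motives with coefficients);
  every closed or parametrised conjecture `def` the tree HAS in `Literature/NumberTheory/{Automorphic,
  GaloisRepresentations,LFunctions,ModularForms,PAdicHodge}`, `Literature/AlgebraicGeometry/{ShimuraVarieties,
  Motives}` and `Literature/Barriers/Langlands` is either WEAKER than `P` (rows 6–7; also
  `exists_galoisRep_of_regularAlgebraic` = HLTT/Scholze, a theorem), INCOMPARABLE (rows 5, 8–10; the standard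
  conjectures `Literature.AlgebraicGeometry.Motives.StandardConjecture*`, `TateConjecture`,
  `MumfordTateConjecture(For)`, `HodgeConjectureOver` do not imply reciprocity in print), or a THEOREM stated
  as a named fact (`SerreModularityConjecture p k` = Khare–Wintenberger; `CaraianiNewton2023_modularity`;
  `BLGGT2014_*`; `ArthurClozel1989_*`). Registering a weaker or incomparable `H` would make the probe
  `H → C` meaningless for T1 rule (a); registering a parametrised predicate is excluded by D-0034 (not a
  closed `Prop`).
* NOT registered on purpose although trivially "stronger": the pre-2026-08-16 typing of the summit with
  `∀ 𝓡` ranging over ARBITRARY (un-pinned) local Langlands data — the Statement docstring records that this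
  reading is refutable by a typing artefact (ramified Hecke characters against a re-normalised `rec₁`); a
  refutable `H` makes every probe `H → C` vacuous.
* ROUTE CRITERIA are cruxes, found by the tribunal's own scan and never tagged here: the many landed
  `SectorComplement ↔ _root_.Langlands` (under sibling cruxes) in `Summits/Langlands/Langlands/Cruxes/
  SectorComplement/Disproof.lean`, the assemblies `… → _root_.Langlands` in `Summits/Langlands/Langlands/
  Theorems/*Assembly*.lean`, and every `Theses` decl (e.g. `GaloisWeightedBE.ExtendedRiemannHypothesis`,
  `EvenArtinQuantumBoundary.BookerCriterion`, `AdjointEulerNumerical.NumericalCriterion`). Summit-side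
  `…Hypothesis` defs under `Cruxes/IrregularClassicality`, `Theorems/PicardMuOrdinaryIrregularClassicalityDefs`
  (`LimitHypothesis`, `TwistedPolarizedLimitHypothesis`, …) are route-internal inputs far BELOW summit
  strength; not tagged.

## Not yet typeable (what vocabulary would unlock rows 1–4)

* Row 1: `structure LGroup (G) …` with `Γ_F`-action on `Ĝ(ℚ̄_p)`, `AutomorphyDatum` for a general connected
  reductive `G/F` (the tree's `LinearAlgebraicGroups` prelude has `IsConnectedReductiveOver k G` as
  `K`-points only, no adelic points, no automorphic spectrum), unramified `r_{π_v}` via the Satake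
  isomorphism for `G`.
* Row 2: a neutral Tannakian formalism (fibre functors, `Aut^⊗`), none in Mathlib.
* Row 3: André/Nori/Grothendieck motives over `F` with coefficients and comparison isomorphisms; the tree's
  `Literature.AlgebraicGeometry.Motives.NoriMotivicInterface` is an interface with junk models
  (`not_forall_gpcForAll`), unusable as a hypothesis head.
* Row 4: nothing missing — budget only (follow-up for a full D-0034 worker: state `LanglandsCAlgebraic` with
  `IsCAlgebraic` + `AlgebraicityTwist`, land `LanglandsCAlgebraic ↔ Langlands`).

## Sources

[BuzzardGeeLMS2014] §3.1–3.2 (Def. 3.1.1, Conj. 3.2.1, 3.2.2, Rem. 3.2.3–3.2.5), §5.3, §8.1;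
[TaylorGaloisRepresentations2004] §§1–3 (Conj. 1.1 Fontaine–Mazur, Conj. 3.4–3.5); [FontaineMazurGeometric1995]
§1 Conj. 1; [Clozel1990] (interim key) Déf. 1.8, §4 Conj. 4.5, 4.16; [Langlands1970] Questions 1–2;
[Corvallis1979] Borel §§15–17; [LanglandsCorvallis1979Notion]; [Langlands2001]; [HarrisTaylorAMS2001] Thm. A;
[HenniartInventiones2000]. Not in `references.bib` (named in prose only): Langlands 1979 "Ein Märchen"
(Corvallis Part 2, pp. 205–246); Arthur 2002, Canad. Math. Bull. 45(4), 466–482.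
-/

namespace Literature.StrongHypotheses.Langlands

/-! ## Registry: empty at skeleton stage (see the module docstring census). -/

end Literature.StrongHypotheses.Langlands
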